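import Literature.NumberTheory.Transcendental.DrinfeldAssociatorRegularisation
import Literature.NumberTheory.Transcendental.ShuffleAlgebra
import HarnessLib

/-!
# IKZ's end regularisation as an end Taylor map; stripping the first letter

Two algebraic facts about Ihara–Kaneko–Zagier's end regularisation
`Shuffle.regEnd x W = Σ_{k ≤ n} (-1)^k xᵏ ш (W minus its last k letters)` over a general alphabet
(Literature versions of the route lemmas `GroupLike.regEnd_apply_eq_endTaylor` and
`regEnd_apply_cons` of `Summits/KontsevichZagierPeriods/…/Theorems`, needed by the cube calculus
`KZCubeWords.lean`):

* `Shuffle.RegEndCons.regEnd_apply_eq_endTaylor`: coefficientwise, `regEnd x W` is the end Taylor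
  (constant-term) map `τ_{|W|+1}(W) = Σ_k (-1)^k xᵏ ш ∂ₓᵏ W` of the derivation `∂ₓ` ("remove a
  final `x`") of the completed shuffle algebra (`ShuffleAlgebra.endTaylor`) — the mirror image of
  [IharaKanekoZagier2006, §2 Prop. 1, §3 Cor. 5];
* `Shuffle.RegEndCons.regEnd_apply_cons`: stripping the FIRST letter `ℓ` is the derivation
  `ℓ∂ = dFront ℓ`, which commutes with `∂ₓ`, whence
  `regEnd x W (ℓ :: v) = [W = ℓ W'] regEnd x W' v - [ℓ = x] [W = U x] regEnd x U v`
  (the gauged transport equation of end-regularised iterated integrals).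

References: K. Ihara, M. Kaneko, D. Zagier, *Derivation and double shuffle relations for multiple
zeta values*, Compos. Math. 142 (2006), §2 Prop. 1, §3, Cor. 5 [cite: IharaKanekoZagier2006, Cor. 5];
C. Reutenauer, *Free Lie algebras* (1993), §1.4–1.5.
-/

noncomputable section

open scoped BigOperators

namespace Literature.NumberTheory.Transcendental.Shuffle

namespace GroupLike

open ShuffleAlgebra

variable {α : Type*} [DecidableEq α]

/-! ## 1. `Shuffle.regEnd` is the end Taylor map of the completed shuffle algebra -/

omit [DecidableEq α] in
/-- `Shuffle.wordSum L` is `Σ_{w ∈ L} w` in the completed shuffle algebra, coefficientwise.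
[folklore] -/
theorem wordSum_apply_eq (L : List (List α)) (v : List α) [DecidableEq α] :
    Shuffle.wordSum L v = ((L.map word).sum : ShuffleAlgebra α ℚ) v := by
  induction L with
  | nil => simp
  | cons w L ih =>
    rw [Shuffle.wordSum_cons, Finsupp.add_apply, ih, List.map_cons, List.sum_cons,
      ShuffleAlgebra.add_apply, Finsupp.single_apply, word_apply]
    by_cases h : v = w
    · subst h; simp
    · rw [if_neg h, if_neg (Ne.symm h)]

/-- `Shuffle.shuffleSum u u'` is the shuffle product `u ш u'` of the completed shuffle algebra,
coefficientwise. [cite: Reutenauer1993, §1.4] -/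
theorem shuffleSum_apply_eq (u u' v : List α) :
    Shuffle.shuffleSum u u' v = (word u * word u' : ShuffleAlgebra α ℚ) v := by
  rw [Shuffle.shuffleSum, wordSum_apply_eq, word_mul_word]

/-- Structure of a word along its trailing block of `x`'s: `w = u₀ xⁿ`, `n = leadCount x w̃`,
with `u₀` not ending in `x`. [cite: IharaKanekoZagier2006, Cor. 5 (w = yᵐ w₀, mirror image)] -/
theorem eq_append_replicate_leadCount (x : α) (w : List α) :
    ∃ u₀ : List α, w = u₀ ++ List.replicate (Shuffle.leadCount x w.reverse) x ∧
      u₀.getLast? ≠ some x := by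
  refine ⟨(w.reverse.drop (Shuffle.leadCount x w.reverse)).reverse, ?_, ?_⟩
  · have h := congrArg List.reverse (Shuffle.replicate_leadCount_append_drop x w.reverse)
    rw [List.reverse_append, List.reverse_replicate, List.reverse_reverse] at h
    exact h.symm
  · rw [List.getLast?_reverse]
    exact Shuffle.drop_leadCount_head_ne x w.reverse

/-- The number of trailing `x`'s is at most the length. [folklore] -/
theorem leadCount_reverse_le_length (x : α) (w : List α) :
    Shuffle.leadCount x w.reverse ≤ w.length := by
  obtain ⟨u₀, hw, -⟩ := eq_append_replicate_leadCount x w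
  have h := congrArg List.length hw
  simp only [List.length_append, List.length_replicate] at h
  omega

/-- `∂ₓᵏ w = (w minus its last k letters)` for `k` at most the number of trailing `x`'s.
[cite: IharaKanekoZagier2006, Cor. 5] -/
theorem dEnd_iterate_word_of_le_leadCount (x : α) (w : List α) {k : ℕ}
    (hk : k ≤ Shuffle.leadCount x w.reverse) :
    (dEnd x)^[k] (word w : ShuffleAlgebra α ℚ) = word (w.take (w.length - k)) := by
  obtain ⟨u₀, hw, -⟩ := eq_append_replicate_leadCount x w
  generalize Shuffle.leadCount x w.reverse = n at hw hk
  subst hw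
  obtain ⟨e, rfl⟩ : ∃ e, n = e + k := ⟨n - k, by omega⟩
  rw [List.replicate_add, ← List.append_assoc]
  have hlen : (u₀ ++ List.replicate e x ++ List.replicate k x).length - k =
      (u₀ ++ List.replicate e x).length := by
    simp only [List.length_append, List.length_replicate]; omega
  rw [hlen, List.take_left]
  ext v
  rw [dEnd_iterate_apply, word_apply, word_apply]
  simp only [List.append_cancel_right_eq]

/-- `∂ₓᵏ w = 0` for `k` beyond the number of trailing `x`'s.
[cite: IharaKanekoZagier2006, Cor. 5] -/
theorem dEnd_iterate_word_of_leadCount_lt (x : α) (w : List α) {k : ℕ}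
    (hk : Shuffle.leadCount x w.reverse < k) :
    (dEnd x)^[k] (word w : ShuffleAlgebra α ℚ) = 0 := by
  obtain ⟨u₀, hw, hu₀⟩ := eq_append_replicate_leadCount x w
  generalize Shuffle.leadCount x w.reverse = n at hw hk
  subst hw
  ext v
  rw [dEnd_iterate_apply, word_apply, ShuffleAlgebra.zero_apply, if_neg]
  intro h
  apply hu₀
  obtain ⟨d, rfl⟩ : ∃ d, k = d + 1 + n := ⟨k - n - 1, by omega⟩
  rw [List.replicate_add, ← List.append_assoc, List.append_cancel_right_eq] at h
  rw [← h, List.replicate_succ', ← List.append_assoc]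
  simp

/-- IKZ's end-regularisation formula with the reversals unfolded:
`regEnd x w = Σ_{k ≤ n} (-1)^k xᵏ ш (w minus its last k letters)`, `n` the number of trailing `x`'s.
[cite: IharaKanekoZagier2006, Cor. 5 (mirror image)] -/
theorem regEnd_eq_sum_take (x : α) (w : List α) :
    Shuffle.regEnd x w = ∑ k ∈ Finset.range (Shuffle.leadCount x w.reverse + 1),
      ((-1 : ℚ) ^ k) • Shuffle.shuffleSum (List.replicate k x) (w.take (w.length - k)) := by
  unfold Shuffle.regEnd Shuffle.regFront
  rw [Finsupp.mapDomain_finsetSum]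
  refine Finset.sum_congr rfl fun k _ => ?_
  rw [Finsupp.mapDomain_smul, ← Shuffle.shuffleSum_reverse, List.reverse_replicate,
    List.drop_reverse, List.reverse_reverse]

/-- **`Shuffle.regEnd x w` is the end Taylor map `τ^{end}_{|w|+1}(w)` of the derivation `∂ₓ`**,
coefficientwise (general alphabet; the `Bool` case is `ShuffleAlgebra.regEnd_apply`).
[cite: IharaKanekoZagier2006, Cor. 5] -/
theorem regEnd_apply_eq_endTaylor (x : α) (w v : List α) :
    Shuffle.regEnd x w v = (endSystem x).taylor (w.length + 1) (word w : ShuffleAlgebra α ℚ) v := by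
  rw [regEnd_eq_sum_take, Finsupp.finsetSum_apply, TaylorSystem.taylor, finset_sum_apply]
  symm
  have hsub : Finset.range (Shuffle.leadCount x w.reverse + 1) ⊆ Finset.range (w.length + 1) :=
    Finset.range_mono (Nat.succ_le_succ (leadCount_reverse_le_length x w))
  refine ((Finset.sum_subset hsub fun k hk hk' => ?_).symm).trans
    (Finset.sum_congr rfl fun k hk => ?_)
  · rw [Finset.mem_range] at hk hk'
    rw [neg_one_pow_mul_apply, endSystem_t, endSystem_D,
      dEnd_iterate_word_of_leadCount_lt x w (by omega), mul_zero, ShuffleAlgebra.zero_apply,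
      mul_zero]
  · rw [Finset.mem_range, Nat.lt_succ_iff] at hk
    rw [Finsupp.smul_apply, shuffleSum_apply_eq, neg_one_pow_mul_apply, endSystem_t, endSystem_D,
      dEnd_iterate_word_of_le_leadCount x w hk, smul_eq_mul]

end GroupLike

namespace RegEndCons

open ShuffleAlgebra

variable {α : Type*} {R : Type*} [CommRing R]

/-- The two elementary derivations commute: `ᵦ∂ ∂ₐ = ∂ₐ ᵦ∂`. [folklore] -/
theorem dFront_dEnd (a b : α) (f : ShuffleAlgebra α R) :
    dFront b (dEnd a f) = dEnd a (dFront b f) := by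
  ext w; rfl

/-- `ᵦ∂` commutes with the iterates `∂ₐᵏ`. [folklore] -/
theorem dFront_dEnd_iterate (a b : α) (k : ℕ) (f : ShuffleAlgebra α R) :
    dFront b ((dEnd a)^[k] f) = (dEnd a)^[k] (dFront b f) := by
  induction k generalizing f with
  | zero => rfl
  | succ k ih => rw [Function.iterate_succ_apply, Function.iterate_succ_apply, ← dFront_dEnd, ih]

/-- `ᵦ∂ ((-1)ᵏ f) = (-1)ᵏ ᵦ∂ f`. [folklore] -/
theorem dFront_neg_one_pow_mul (b : α) (k : ℕ) (f : ShuffleAlgebra α R) :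
    dFront b ((-1) ^ k * f) = (-1) ^ k * dFront b f := by
  rcases neg_one_pow_eq_or (ShuffleAlgebra α R) k with h | h <;> rw [h]
  · rw [one_mul, one_mul]
  · rw [neg_one_mul, neg_one_mul, map_neg]

/-- The Taylor map of a Taylor system kills `0`. [folklore] -/
theorem taylor_zero {A : Type*} [CommRing A] (T : TaylorSystem A) (N : ℕ) : T.taylor N 0 = 0 := by
  unfold TaylorSystem.taylor
  exact Finset.sum_eq_zero fun k _ => by rw [iterate_map_zero, mul_zero, mul_zero]

variable [DecidableEq α]

/-- `ᵦ∂ (∅) = 0`: the empty word has no first letter. [folklore] -/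
theorem dFront_word_nil (b : α) : dFront b (word ([] : List α) : ShuffleAlgebra α R) = 0 :=
  dFront_word_of_ne b (by simp)

/-- `ₓ∂ (xᵏ⁺¹) = xᵏ`. [folklore] -/
theorem dFront_word_replicate_succ_self (x : α) (k : ℕ) :
    dFront x (word (List.replicate (k + 1) x) : ShuffleAlgebra α R) = word (List.replicate k x) := by
  rw [List.replicate_succ]
  exact dFront_word_cons x _

/-- `ℓ∂ (xᵏ) = 0` for a letter `ℓ ≠ x`. [folklore] -/
theorem dFront_word_replicate_of_ne {x ℓ : α} (h : ℓ ≠ x) (k : ℕ) :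
    dFront ℓ (word (List.replicate k x) : ShuffleAlgebra α R) = 0 := by
  refine dFront_word_of_ne ℓ ?_
  cases k with
  | zero => simp
  | succ k =>
    rw [List.replicate_succ, List.head?_cons, Ne, Option.some.injEq]
    exact fun e => h e.symm

/-- **First-letter stripping through the end Taylor map**: since `ℓ∂` is a derivation commuting
with `∂ₓ` and `ℓ∂(xᵏ⁺¹) = [ℓ = x] xᵏ`, the Leibniz rule gives
`ℓ∂ (τ_{N+1} f) = τ_{N+1} (ℓ∂ f) - [ℓ = x] τ_N (∂ₓ f)` (the sum over `k ≥ 1` re-indexes to the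
Taylor sum of `∂ₓ f` with the opposite sign). [cite: IharaKanekoZagier2006, Cor. 5 (mirror image)] -/
theorem dFront_endTaylor (x ℓ : α) (N : ℕ) (f : ShuffleAlgebra α R) :
    dFront ℓ ((endSystem x).taylor (N + 1) f) =
      (endSystem x).taylor (N + 1) (dFront ℓ f) -
        if ℓ = x then (endSystem x).taylor N (dEnd x f) else 0 := by
  -- the Leibniz rule, term by term
  have hterm : ∀ k : ℕ, dFront ℓ ((-1) ^ k * (word (List.replicate k x) * (dEnd x)^[k] f) :
      ShuffleAlgebra α R) =
      (-1) ^ k * (dFront ℓ (word (List.replicate k x)) * (dEnd x)^[k] f) +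
        (-1) ^ k * (word (List.replicate k x) * (dEnd x)^[k] (dFront ℓ f)) := by
    intro k
    rw [dFront_neg_one_pow_mul, dFront_mul, dFront_dEnd_iterate, mul_add]
  -- the first family of terms: `Σ_{k ≤ N} (-1)^k ℓ∂(xᵏ) ∂ₓᵏ f = -[ℓ = x] τ_N (∂ₓ f)`
  have hA : ∑ k ∈ Finset.range (N + 1),
      ((-1 : ShuffleAlgebra α R) ^ k * (dFront ℓ (word (List.replicate k x)) * (dEnd x)^[k] f)) =
      -(if ℓ = x then (endSystem x).taylor N (dEnd x f) else 0) := by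
    rw [Finset.sum_range_succ', List.replicate_zero, dFront_word_nil, zero_mul, mul_zero, add_zero]
    split_ifs with hℓ
    · subst hℓ
      rw [TaylorSystem.taylor, ← Finset.sum_neg_distrib]
      refine Finset.sum_congr rfl fun k _ => ?_
      rw [dFront_word_replicate_succ_self, Function.iterate_succ_apply, endSystem_D, endSystem_t,
        pow_succ]
      ring
    · rw [neg_zero]
      exact Finset.sum_eq_zero fun k _ => by
        rw [dFront_word_replicate_of_ne hℓ, zero_mul, mul_zero]
  calc dFront ℓ ((endSystem x).taylor (N + 1) f)
      = ∑ k ∈ Finset.range (N + 1),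
          dFront ℓ ((-1) ^ k * (word (List.replicate k x) * (dEnd x)^[k] f)) := by
        rw [TaylorSystem.taylor, map_sum]; rfl
    _ = ∑ k ∈ Finset.range (N + 1),
          ((-1 : ShuffleAlgebra α R) ^ k *
            (dFront ℓ (word (List.replicate k x)) * (dEnd x)^[k] f)) +
        ∑ k ∈ Finset.range (N + 1),
          ((-1 : ShuffleAlgebra α R) ^ k *
            (word (List.replicate k x) * (dEnd x)^[k] (dFront ℓ f))) := by
        rw [← Finset.sum_add_distrib]
        exact Finset.sum_congr rfl fun k _ => hterm k
    _ = (endSystem x).taylor (N + 1) (dFront ℓ f) -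
        if ℓ = x then (endSystem x).taylor N (dEnd x f) else 0 := by
        rw [hA, TaylorSystem.taylor, neg_add_eq_sub]
        rfl

end RegEndCons

open ShuffleAlgebra GroupLike RegEndCons in
/-- **Stripping the first letter through IKZ's end regularisation**:
`regEnd x W (ℓ :: v) = [W = ℓ W'] regEnd x W' v - [ℓ = x ∧ W = U x] regEnd x U v`.
Coefficientwise this is the derivation identity `ℓ∂ ∘ τ = τ ∘ ℓ∂ - [ℓ = x] τ ∘ ∂ₓ` for the end
Taylor map of the completed shuffle algebra (`RegEndCons.dFront_endTaylor`); analytically it is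
the gauged transport equation `∂_β Q = Ω Q - Q·x/β` of end-regularised iterated integrals.
[cite: IharaKanekoZagier2006, Cor. 5 (mirror image)] -/
theorem regEnd_apply_cons : ∀ (α : Type) [DecidableEq α] (x ℓ : α) (W v : List α), Shuffle.regEnd x W (ℓ :: v) = (if W.head? = some ℓ then Shuffle.regEnd x W.tail v else 0) - (if ℓ = x ∧ W.getLast? = some x then Shuffle.regEnd x W.dropLast v else 0) := by
  intro α _ x ℓ W v
  rw [regEnd_apply_eq_endTaylor, ← dFront_apply, dFront_endTaylor, ShuffleAlgebra.sub_apply]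
  congr 1
  · -- `τ_{|W|+1} (ℓ∂ W) v = [W = ℓ W'] regEnd x W' v`
    cases W with
    | nil => rw [dFront_word_nil, taylor_zero, ShuffleAlgebra.zero_apply, if_neg (by simp)]
    | cons a W =>
      by_cases ha : a = ℓ
      · subst ha
        rw [dFront_word_cons, List.length_cons,
          (endSystem x).taylor_eq_of_le (dEnd_iterate_word_eq_zero x W) (by omega),
          ← regEnd_apply_eq_endTaylor, List.head?_cons, if_pos rfl, List.tail_cons]
      · have hne : (a :: W).head? ≠ some ℓ := by
          rw [List.head?_cons, Ne, Option.some.injEq]; exact ha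
        rw [dFront_word_of_ne ℓ hne, taylor_zero, ShuffleAlgebra.zero_apply, if_neg hne]
  · -- `[ℓ = x] τ_{|W|} (∂ₓ W) v = [ℓ = x ∧ W = U x] regEnd x U v`
    by_cases hℓ : ℓ = x
    · subst hℓ
      rw [if_pos rfl]
      by_cases hW : W.getLast? = some ℓ
      · obtain ⟨U, rfl⟩ := List.getLast?_eq_some_iff.mp hW
        rw [if_pos ⟨rfl, hW⟩, dEnd_word_append, List.length_append, List.length_singleton,
          ← regEnd_apply_eq_endTaylor, List.dropLast_concat]
      · rw [if_neg fun h => hW h.2, dEnd_word_of_ne ℓ hW, taylor_zero, ShuffleAlgebra.zero_apply]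
    · rw [if_neg hℓ, if_neg fun h => hℓ h.1, ShuffleAlgebra.zero_apply]


end Literature.NumberTheory.Transcendental.Shuffle
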